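import Summits.Ventures.Crystal3D.Theorems.StickyWulffConstantNoReconstructionGainExactFlat
import HarnessLib

/-!
# Replication, preparations: lattice heights, bodies, far unions, enumeration (line `replication-exactness`)

HONEST FRAMING. Part of the venture `Summits/Ventures/Crystal3D` (cell `crystal3d-full`), supports the
crux `NoReconstructionGain` (stmt-Ventures-19144, route `route-Ventures-StickyWulffConstant`), line
`replication-exactness` (skeleton v2, lead wulff-p1 g17), bookkeeping bricks for the licence stub
`stub_replication` (`NoReconstructionGain → ExactZeroGain`):

* `exists_fcc_height_mem_Icc` — a lattice vector of `ν`-height in any interval `[y, y + 1]`;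
* `exists_latticeBody` — the clamped lattice slab `Λ₀ ∩ {a ≤ ⟪z,ν⟫ ≤ b, ‖z‖² − ⟪z,ν⟫² ≤ ρ²}` as a
  `Finset`;
* `contactDeficiency_union_of_far`, `contactDeficiency_biUnion_of_far` — deficiencies ADD over pieces
  that are `> 1` apart;
* `card_cross_biUnion` — cross counts add over a disjoint union of film pieces;
* `plugSet_ncard_le_card_filter` — plugs that lie in a finite substrate are substrate contacts;
* `exists_unitPacking_of_finset` — a finite set of centres pairwise `≥ 1` apart, enumerated, is a unit
  packing `x : Fin N → ℝ³` with `univ.image x = X` and `6N − numContacts x = D(X)`.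

WHAT THIS IS NOT: the replication argument itself is the next file; rung F-C1 not moved.
-/

noncomputable section

namespace Summit.Ventures.Crystal3D.Theorems

open Summit.Ventures.Crystal3D
open Literature.MathematicalPhysics.StatisticalMechanics (fccStacking barlowStacking barlowPos constHagg
  barlowPos_mem isHaggSeq_const le_dist_of_mem_barlowStacking_ideal contactDeficiency orderedContacts
  UniformlyDiscrete)
open scoped InnerProductSpace
open Finset

/-! ## Lattice heights hit every unit interval -/

/-- For every unit `ν` and every `y` there is a lattice vector of `ν`-height in `[y, y + 1]`. -/
theorem exists_fcc_height_mem_Icc {ν : EuclideanSpace ℝ (Fin 3)} (hν : ‖ν‖ = 1) (y : ℝ) :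
    ∃ t ∈ fccStacking 1 (Real.sqrt (2 / 3)), y ≤ ⟪t, ν⟫_ℝ ∧ ⟪t, ν⟫_ℝ ≤ y + 1 := by
  -- a generator with positive height `η ≤ 1`
  have key : ∀ e : EuclideanSpace ℝ (Fin 3), e ∈ fccStacking 1 (Real.sqrt (2 / 3)) → ‖e‖ = 1 →
      ⟪e, ν⟫_ℝ ≠ 0 → ∃ t ∈ fccStacking 1 (Real.sqrt (2 / 3)), y ≤ ⟪t, ν⟫_ℝ ∧ ⟪t, ν⟫_ℝ ≤ y + 1 := by
    intro e he hne h0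
    -- replace `e` by `±e` with positive height
    obtain ⟨f, hf, hfn, hfpos⟩ : ∃ f ∈ fccStacking 1 (Real.sqrt (2 / 3)), ‖f‖ = 1 ∧ 0 < ⟪f, ν⟫_ℝ := by
      rcases lt_or_gt_of_ne h0 with h | h
      · refine ⟨-e, ?_, by rw [norm_neg, hne], by rw [inner_neg_left]; linarith⟩
        have := fcc_zsmul_mem (-1) he
        simpa using this
      · exact ⟨e, he, hne, h⟩
    set η := ⟪f, ν⟫_ℝ with hη
    have hη1 : η ≤ 1 := by
      have := abs_real_inner_le_norm f ν
      rw [hfn, hν, one_mul] at this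
      exact (le_abs_self _).trans this
    refine ⟨((⌈y / η⌉ : ℤ) : ℝ) • f, fcc_zsmul_mem _ hf, ?_, ?_⟩
    · rw [inner_smul_left, conj_trivial]
      have h1 : y / η ≤ (⌈y / η⌉ : ℤ) := Int.le_ceil _
      rw [div_le_iff₀ hfpos] at h1
      linarith
    · rw [inner_smul_left, conj_trivial]
      have h1 : ((⌈y / η⌉ : ℤ) : ℝ) < y / η + 1 := Int.ceil_lt_add_one _
      have h2 : ((⌈y / η⌉ : ℤ) : ℝ) * η < (y / η + 1) * η := mul_lt_mul_of_pos_right h1 hfpos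
      have h3 : (y / η + 1) * η = y + η := by field_simp
      linarith
  obtain ⟨hn1, hn2, hn3⟩ := norm_fcc_gen
  rcases inner_fcc_gen_ne_zero hν with h | h | h
  · exact key _ (barlowPos_mem 0 1 0) hn1 h
  · exact key _ (barlowPos_mem 0 0 1) hn2 h
  · exact key _ (barlowPos_mem 1 0 0) hn3 h

/-! ## The clamped lattice slab as a finite set -/

/-- The clamped lattice slab `Λ₀ ∩ {a ≤ ⟪z,ν⟫ ≤ b, ‖z‖² − ⟪z,ν⟫² ≤ ρ²}` is finite; here it is as a
`Finset`. -/
theorem exists_latticeBody (ν : EuclideanSpace ℝ (Fin 3)) (a b ρ : ℝ) :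
    ∃ L : Finset (EuclideanSpace ℝ (Fin 3)), ∀ z, z ∈ L ↔
      (z ∈ fccStacking 1 (Real.sqrt (2 / 3)) ∧ a ≤ ⟪z, ν⟫_ℝ ∧ ⟪z, ν⟫_ℝ ≤ b ∧
        ‖z‖ ^ 2 - ⟪z, ν⟫_ℝ ^ 2 ≤ ρ ^ 2) := by
  classical
  have hfin := fcc_uniformlyDiscrete.finite_inter_closedBall 0 (|ρ| + |a| + |b|)
  refine ⟨hfin.toFinset.filter fun z => a ≤ ⟪z, ν⟫_ℝ ∧ ⟪z, ν⟫_ℝ ≤ b ∧ ‖z‖ ^ 2 - ⟪z, ν⟫_ℝ ^ 2 ≤ ρ ^ 2,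
    fun z => ?_⟩
  rw [Finset.mem_filter, Set.Finite.mem_toFinset, Set.mem_inter_iff, Metric.mem_closedBall, dist_zero_right]
  constructor
  · rintro ⟨⟨hz, -⟩, h1, h2, h3⟩
    exact ⟨hz, h1, h2, h3⟩
  · rintro ⟨hz, h1, h2, h3⟩
    refine ⟨⟨hz, ?_⟩, h1, h2, h3⟩
    have hh : |⟪z, ν⟫_ℝ| ≤ |a| + |b| := by
      rw [abs_le]; constructor
      · linarith [neg_abs_le a, abs_nonneg b]
      · linarith [le_abs_self b, abs_nonneg a]
    have h4 : ‖z‖ ^ 2 ≤ (|ρ| + |a| + |b|) ^ 2 := by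
      have : ⟪z, ν⟫_ℝ ^ 2 ≤ (|a| + |b|) ^ 2 := by
        rw [← sq_abs]; exact pow_le_pow_left₀ (abs_nonneg _) hh 2
      have hρ2 : ρ ^ 2 = |ρ| ^ 2 := (sq_abs ρ).symm
      nlinarith [abs_nonneg ρ, abs_nonneg a, abs_nonneg b]
    exact le_of_pow_le_pow_left₀ two_ne_zero (by positivity) h4

/-! ## Deficiencies add over far pieces -/

/-- Two configurations `> 1` apart: the deficiency of the union is the sum. -/
theorem contactDeficiency_union_of_far (A B : Finset (EuclideanSpace ℝ (Fin 3)))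
    (hfar : ∀ a ∈ A, ∀ b ∈ B, 1 < dist a b) :
    contactDeficiency (A ∪ B) = contactDeficiency A + contactDeficiency B := by
  classical
  have hdisj : Disjoint A B := by
    rw [Finset.disjoint_left]
    intro a ha hb
    have := hfar a ha a hb
    rw [dist_self] at this; linarith
  have h := contactDeficiency_sdiff_split (X := A ∪ B) (P := A) Finset.subset_union_left
  rw [Finset.union_sdiff_cancel_left hdisj] at h
  have h0 : ((A ×ˢ B).filter fun pq => dist pq.1 pq.2 = 1).card = 0 := by
    rw [Finset.card_eq_zero, Finset.filter_eq_empty_iff]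
    intro pq hpq heq
    rw [Finset.mem_product] at hpq
    have := hfar pq.1 hpq.1 pq.2 hpq.2
    linarith
  rw [h, h0]; push_cast; ring

/-- A finite family of configurations pairwise `> 1` apart: the deficiency of the union is the sum. -/
theorem contactDeficiency_biUnion_of_far {ι : Type*} (T : Finset ι)
    (G : ι → Finset (EuclideanSpace ℝ (Fin 3)))
    (hfar : ∀ i ∈ T, ∀ j ∈ T, i ≠ j → ∀ a ∈ G i, ∀ b ∈ G j, 1 < dist a b) :
    contactDeficiency (T.biUnion G) = ∑ i ∈ T, contactDeficiency (G i) := by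
  classical
  induction T using Finset.induction_on with
  | empty => simp [contactDeficiency_empty]
  | @insert i T hi ih =>
    rw [Finset.biUnion_insert, Finset.sum_insert hi,
      contactDeficiency_union_of_far _ _ ?_, ih fun i' hi' j' hj' hne => hfar i' (Finset.mem_insert_of_mem hi')
        j' (Finset.mem_insert_of_mem hj') hne]
    intro a ha b hb
    rw [Finset.mem_biUnion] at hb
    obtain ⟨j, hj, hbj⟩ := hb
    have hij : i ≠ j := by rintro rfl; exact hi hj
    exact hfar i (Finset.mem_insert_self i T) j (Finset.mem_insert_of_mem hj) hij a ha b hbj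

/-- Cross counts add over a pairwise disjoint union of film pieces. -/
theorem card_cross_biUnion {ι : Type*} (L : Finset (EuclideanSpace ℝ (Fin 3))) (T : Finset ι)
    (G : ι → Finset (EuclideanSpace ℝ (Fin 3)))
    (hdisj : ∀ i ∈ T, ∀ j ∈ T, i ≠ j → Disjoint (G i) (G j)) :
    ((L ×ˢ T.biUnion G).filter fun pq => dist pq.1 pq.2 = 1).card =
      ∑ i ∈ T, ((L ×ˢ G i).filter fun pq => dist pq.1 pq.2 = 1).card := by
  classical
  rw [card_cross_eq_sum, Finset.sum_biUnion hdisj]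
  refine Finset.sum_congr rfl fun i _ => ?_
  rw [card_cross_eq_sum]

/-- Plugs lying in a finite substrate are substrate contacts. -/
theorem plugSet_ncard_le_card_filter (ν : EuclideanSpace ℝ (Fin 3)) (c : ℝ)
    (L : Finset (EuclideanSpace ℝ (Fin 3))) (q : EuclideanSpace ℝ (Fin 3))
    (h : ∀ z ∈ plugSet ν c q, z ∈ L) :
    (plugSet ν c q).ncard ≤ (L.filter fun z => dist z q = 1).card := by
  classical
  rw [← Set.ncard_coe_finset]
  refine Set.ncard_le_ncard ?_ (Finset.finite_toSet _)
  intro z hz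
  rw [Finset.mem_coe, Finset.mem_filter]
  exact ⟨h z hz, by rw [dist_comm]; exact hz.2⟩

/-! ## Enumerating a finite packing -/

/-- A finite set of centres pairwise `≥ 1` apart is (enumerated) a unit packing with the same point set,
and `6N − numContacts = D`. -/
theorem exists_unitPacking_of_finset (X : Finset (EuclideanSpace ℝ (Fin 3)))
    (hX : ∀ p ∈ X, ∀ q ∈ X, p ≠ q → 1 ≤ dist p q) :
    ∃ (N : ℕ) (x : Fin N → EuclideanSpace ℝ (Fin 3)), IsUnitPacking x ∧
      (∀ p ∈ X, ∃ i, x i = p) ∧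
      6 * (N : ℝ) - (numContacts x : ℝ) = contactDeficiency X := by
  classical
  set N := X.card with hN
  set x : Fin N → EuclideanSpace ℝ (Fin 3) := fun i => ((X.equivFin.symm i : X) : _) with hxdef
  have hxinj : Function.Injective x := fun i j h =>
    X.equivFin.symm.injective (Subtype.ext h)
  have hmem : ∀ i, x i ∈ X := fun i => (X.equivFin.symm i).2
  have himage : univ.image x = X := by
    ext p
    simp only [mem_image, mem_univ, true_and]
    constructor
    · rintro ⟨i, rfl⟩
      exact hmem i
    · intro hp
      exact ⟨X.equivFin ⟨p, hp⟩, by simp [hxdef]⟩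
  have hpack : IsUnitPacking x := fun i j hij =>
    hX _ (hmem i) _ (hmem j) (fun h => hij (hxinj h))
  refine ⟨N, x, hpack, fun p hp => ⟨X.equivFin ⟨p, hp⟩, by simp [hxdef]⟩, ?_⟩
  rw [← contactDeficiency_image_eq x hxinj, himage]

end Summit.Ventures.Crystal3D.Theorems

end
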